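import Summits.AtomisticToContinuum.FouriersLaw.Theorems.HiddenChargeMazurStaticKuboStubHighEnergyDecayRateAux

/-!
# `HiddenChargeMazur.StaticKubo`, line `birth`, stub `stub_highEnergyDecayRate` — CEHR Thm 5.1 with a rate

Helper file (`--supports stmt-AtomisticToContinuum-13510`, crux decl `HiddenChargeMazur.StaticKubo`,
registered stub `stub_highEnergyDecayRate` of the skeleton `Cruxes/StaticKubo/Lines/birth.lean`, rev 4).

For the pinned anharmonic chain `pinnedChain ω₂ lam β γ` (all parameters `> 0`), `N ≥ 2`,
`T_L, T_R > 0`, `0 < θ < 1/T_max` and `t* > 0`: GIVEN the sub-Gaussian tail of the running supremum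
of the Brownian pair (`P((goodEvent a h)ᶜ) ≤ C e^{-c a²/h}`, the neighbouring stub
`stub_brownianSupGaussTail`, taken here as a hypothesis), there are `c > 0`, `C`, `E₀` with
`E_x e^{θH(X_{t*})} ≤ C exp(θH(x) − c H(x)^{3/4})` whenever `H(x) ≥ E₀` — Cuneo–Eckmann–Hairer–Rey-Bellet
2018, Theorem 5.1 (printed rate `e^{-C₁H}`) for this chain, with the rate `e^{-cH^{3/4}}`.

Proof: the grid decomposition of the in-tree qualitative version
`pinnedChain_lintegral_exp_hamiltonian_small` (`LangevinChainTheorem51.lean`) verbatim — scale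
`a = H(x)^{1/4}`, grid `Jτ = t*`, `Λ₀/a ≤ τ ≤ 2Λ₀/a`; events `SΓ` (dissipation `≥ γε₁t*E`), `D_j` (low
grid energy), `U_j` (high grid energy), `Nb_j` (bad noise cell); Cor. 5.4 on good paths
(`pinnedChain_grid_dissipation_ge`), the exponential supermartingale (Lemma 5.5), the restart bound
(5.15), Chebyshev (Lemma 5.6) and Hölder with (3.4) — with ONE change: the noise-cell bound
`P(Nb_j)`, the only polynomially small term of the in-tree estimate (the `O(h²)` Doob tail), is
replaced by the sub-Gaussian hypothesis: `P(Nb_j) ≤ max(C,0) e^{-(c m₁²/(2Λ₀)) a³}`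
(`highEnergyDecayRate_noiseCell_le`). The real-number bookkeeping
(`stub_highEnergyDecayRate_bookkeeping`, aux file) then gives `≤ C exp(θE − c a³)`, `a³ = E^{3/4}`.

References: N. Cuneo, J.-P. Eckmann, M. Hairer, L. Rey-Bellet, *Non-equilibrium steady states for
networks of oscillators*, EJP 23 (2018) no. 55, Thm 5.1, eq. (5.1), Prop. 5.3, Cor. 5.4,
Lemmas 5.5–5.6; L. Rey-Bellet, L. E. Thomas, CMP 225 (2002) Thm 3.1.
-/

noncomputable section

open MeasureTheory ProbabilityTheory Filter Topology Set Metric Finset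
open scoped NNReal ENNReal
open Literature.MathematicalPhysics.KineticTheory.HeatConduction Literature.MathematicalPhysics.KineticTheory
open Literature.Probability.Process OscillatorChain

namespace Summit.AtomisticToContinuum.FouriersLaw.Cruxes.StaticKubo.Birth.Stubs

-- the flow is a limit of Picard iterations: never let the unifier unfold it (heartbeats)
attribute [local irreducible] OscillatorChain.chainFlow

/-- **S3 — `stub_highEnergyDecayRate` (CEHR Thm 5.1 for the pinned chain WITH A RATE), proved.**
Given the sub-Gaussian running-sup tail of the Brownian pair: for `ω₂, lam, β, γ > 0`, `N ≥ 2`,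
`T_L, T_R > 0`, `0 < θ < 1/T_max`, `t* > 0` there are `c > 0`, `C`, `E₀` with
`E_x e^{θH(X_{t*})} ≤ C exp(θH(x) − c H(x)^{3/4})` whenever `H(x) ≥ E₀`. The in-tree grid proof of
`pinnedChain_lintegral_exp_hamiltonian_small` with the `O(τ²/a⁴)` noise-cell tail replaced by the
hypothesis (`P(Nb_j) ≤ max(C,0) e^{-c m₁² a³/(2Λ₀)}`), followed by the bookkeeping
`stub_highEnergyDecayRate_bookkeeping`. [cite: CuneoEckmannHairerReyBellet2018, Thm 5.1 eq. (5.1)] -/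
theorem stub_highEnergyDecayRate :
    (∃ C c : ℝ, 0 < c ∧ ∀ (a : ℝ) (h : ℝ≥0), 0 < a → 0 < (h : ℝ) →
      wienerPair (goodEvent a h)ᶜ ≤ ENNReal.ofReal (C * Real.exp (-(c * a ^ 2 / h)))) →
    ∀ ω₂ lam β γ : ℝ, 0 < ω₂ → 0 < lam → 0 < β → 0 < γ → ∀ N : ℕ, 1 < N → ∀ T_L T_R : ℝ, 0 < T_L → 0 < T_R →
      ∀ θ : ℝ, 0 < θ → θ < 1 / max T_L T_R → ∀ tstar : ℝ, 0 < tstar →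
        ∃ c C E₀ : ℝ, 0 < c ∧ ∀ x : PhaseSpace N, E₀ ≤ (pinnedChain ω₂ lam β γ).hamiltonian N x →
          ∫⁻ ω, ENNReal.ofReal (Real.exp (θ * (pinnedChain ω₂ lam β γ).hamiltonian N
              ((pinnedChain ω₂ lam β γ).solMap N T_L T_R tstar x (pairPath ω)))) ∂wienerPair ≤
            ENNReal.ofReal (C * Real.exp (θ * (pinnedChain ω₂ lam β γ).hamiltonian N x -
              c * (pinnedChain ω₂ lam β γ).hamiltonian N x ^ (3 / 4 : ℝ))) := by
  intro hTail ω₂ lam β γ hω hl hβ hγ N hN T_L T_R hTL hTR θ hθ hθ' tstar hts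
  obtain ⟨Cg, cg, hcg, hTail⟩ := hTail
  set P := pinnedChain ω₂ lam β γ with hP
  have hN0 : 0 < N := by omega
  have hTm : 0 < max T_L T_R := lt_max_of_lt_left hTL
  have hθT : θ * max T_L T_R < 1 := (lt_div_iff₀ hTm).1 hθ'
  -- constants of the estimate
  set κ : ℝ := θ * (1 - θ * max T_L T_R) with hκ
  have hκ0 : 0 < κ := mul_pos hθ (by linarith only [hθT])
  set Cst : ℝ := θ * γ * (T_L + T_R) with hCst
  have hCst0 : 0 ≤ Cst := by positivity
  -- the Hölder exponent: `1 < p`, `pθ < 1/T_max`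
  set p : ℝ := (1 + 1 / (θ * max T_L T_R)) / 2 with hp
  have hθT0 : 0 < θ * max T_L T_R := by positivity
  have hp1 : 1 < p := by
    rw [hp]
    have : 1 < 1 / (θ * max T_L T_R) := by rw [lt_div_iff₀ hθT0]; linarith only [hθT]
    linarith only [this]
  have hpθ : p * θ < 1 / max T_L T_R := by
    rw [lt_div_iff₀ hTm, hp]
    have h1 : (1 + 1 / (θ * max T_L T_R)) / 2 * θ * max T_L T_R = (θ * max T_L T_R + 1) / 2 := by
      field_simp
    calc (1 + 1 / (θ * max T_L T_R)) / 2 * θ * max T_L T_R = (θ * max T_L T_R + 1) / 2 := h1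
      _ < 1 := by linarith only [hθT]
  have hpq := Real.HolderConjugate.conjExponent hp1
  set q := Real.conjExponent p with hq
  have hq0 : 0 < 1 / q := by have := hpq.symm.pos; positivity
  have hq1 : 1 / q ≤ 1 := (div_le_one hpq.symm.pos).2 hpq.symm.lt.le
  -- the deterministic inputs
  obtain ⟨Λ₀, ε₁, δ₀, a₀, hΛ₀, hε₁, hδ₀, -, hF5⟩ := pinnedChain_dissipation_lower_bound hω hl hβ hγ.le hN0
  obtain ⟨m₀, a₁, hm₀, -, hcell⟩ := pinnedChain_cell_energy_le hω hl.le hβ.le hγ.le N hΛ₀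
  set cmax : ℝ := max (Real.sqrt (2 * γ * T_L)) (Real.sqrt (2 * γ * T_R)) with hcmax
  have hcmax0 : 0 ≤ cmax := le_max_of_le_left (Real.sqrt_nonneg _)
  set m₁ : ℝ := m₀ / (cmax + 1) with hm₁
  have hm₁0 : 0 < m₁ := by positivity
  have hm₁le : cmax * m₁ ≤ m₀ := by
    rw [hm₁, mul_div_assoc']
    rw [div_le_iff₀ (by positivity)]
    nlinarith only [hcmax0, hm₀]
  -- the bookkeeping: rate `c`, constant `C`, threshold `A`
  obtain ⟨c, C, A, hc, hA1, hbook⟩ := stub_highEnergyDecayRate_bookkeeping θ κ (Cst * tstar)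
    (γ * ε₁ * tstar) (tstar / Λ₀) (max Cg 0) (cg * m₁ ^ 2 / (2 * Λ₀)) (1 / q) hθ hκ0 (by positivity)
    (by positivity) (le_max_right _ _) (by positivity) hq0 hq1
  set A' : ℝ := max (max (max A a₀) (max a₁ (2 * Λ₀ / tstar))) (m₀ / δ₀) with hA'
  have hA'1 : 1 ≤ A' :=
    hA1.trans (((le_max_left _ _).trans (le_max_left _ _)).trans (le_max_left _ _))
  refine ⟨c, C, A' ^ 4, hc, fun x hx => ?_⟩
  ----------------------------------------------------------------
  -- Step 1: the scale `a = H(x)^{1/4}` and the grid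
  ----------------------------------------------------------------
  set E : ℝ := P.hamiltonian N x with hE
  have hE0 : 0 ≤ E := le_trans (by positivity) hx
  set a : ℝ := Real.sqrt (Real.sqrt E) with ha
  have ha4 : a ^ 4 = E := by
    rw [ha, show (4 : ℕ) = 2 * 2 from rfl, pow_mul, Real.sq_sqrt (Real.sqrt_nonneg _), Real.sq_sqrt hE0]
  have ha3 : a ^ 3 = E ^ (3 / 4 : ℝ) := by rw [ha]; exact highEnergyDecayRate_sqrt_sqrt_pow_three hE0
  have haA' : A' ≤ a := by
    have h1 : Real.sqrt (Real.sqrt (A' ^ 4)) = A' := by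
      rw [show A' ^ 4 = (A' ^ 2) ^ 2 by ring, Real.sqrt_sq (by positivity), Real.sqrt_sq (by positivity)]
    rw [← h1, ha]
    exact Real.sqrt_le_sqrt (Real.sqrt_le_sqrt hx)
  have haA : A ≤ a := (((le_max_left _ _).trans (le_max_left _ _)).trans (le_max_left _ _)).trans haA'
  have haa₀ : a₀ ≤ a := (((le_max_right _ _).trans (le_max_left _ _)).trans (le_max_left _ _)).trans haA'
  have haa₁ : a₁ ≤ a := (((le_max_left _ _).trans (le_max_right _ _)).trans (le_max_left _ _)).trans haA'
  have hΛa : 2 * Λ₀ / tstar ≤ a :=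
    (((le_max_right _ _).trans (le_max_right _ _)).trans (le_max_left _ _)).trans haA'
  have hmδa : m₀ / δ₀ ≤ a := (le_max_right _ _).trans haA'
  have ha1 : 1 ≤ a := hA'1.trans haA'
  have ha0 : 0 < a := by linarith only [ha1]
  -- the grid: `Jτ = t*`, `Λ₀/a ≤ τ ≤ 2Λ₀/a`, `J ≤ t* a/Λ₀`
  obtain ⟨J, τ, hτ0, hJ1, hJτ, hτ1, hτ2, hJr⟩ := highEnergyDecayRate_grid hΛ₀ hts ha0 hΛa
  have hjτ : ∀ j : ℕ, j < J + 1 → (j : ℝ) * τ ≤ tstar := fun j hj => by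
    have : (j : ℝ) ≤ J := by exact_mod_cast Nat.lt_succ_iff.1 hj
    calc (j : ℝ) * τ ≤ J * τ := mul_le_mul_of_nonneg_right this hτ0.le
      _ = tstar := hJτ
  -- small-noise thresholds
  have hnoise2 : m₀ * a ≤ δ₀ * a ^ 2 := by
    have : m₀ ≤ δ₀ * a := by rw [div_le_iff₀ hδ₀] at hmδa; linarith only [hmδa]
    nlinarith only [this, ha0.le]
  have hnoise : cmax * (m₁ * a) ≤ m₀ * a := by
    rw [← mul_assoc]; exact mul_le_mul_of_nonneg_right hm₁le ha0.le
  have hm'0 : 0 ≤ m₁ * a := by positivity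
  ----------------------------------------------------------------
  -- Step 2: the events
  ----------------------------------------------------------------
  set H := P.hamiltonian N with hH
  have hHm : Measurable H := (pinnedChain_continuous_hamiltonian ω₂ lam β γ N).measurable
  set z : ℕ → WienerPair → PhaseSpace N := fun j ω => P.solMap N T_L T_R (j * τ) x (pairPath ω) with hz
  have hzm : ∀ j, Measurable (z j) := fun j =>
    pinnedChain_measurable_solMap_pairPath_right hω hl.le hβ.le hγ.le N T_L T_R _ x
  set F : WienerPair → ℝ≥0∞ := fun ω =>
    ENNReal.ofReal (Real.exp (θ * H (P.solMap N T_L T_R tstar x (pairPath ω)))) with hF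
  have hFm : Measurable F := ENNReal.measurable_ofReal.comp (Real.measurable_exp.comp
    ((hHm.comp (pinnedChain_measurable_solMap_pairPath_right hω hl.le hβ.le hγ.le N T_L T_R tstar x)).const_mul _))
  set Γ : WienerPair → ℝ := fun ω => P.dissipation N x (P.pairNoise N T_L T_R (pairPath ω)) tstar with hΓ
  have hΓm : Measurable Γ := pinnedChain_measurable_dissipation_pairPath hω hl.le hβ.le hγ.le N tstar x
  set g : ℝ := γ * ε₁ * tstar * E with hg
  set SΓ : Set WienerPair := {ω | g ≤ Γ ω} with hSΓ
  have hSΓm : MeasurableSet SΓ := measurableSet_le measurable_const hΓm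
  set D : ℕ → Set WienerPair := fun j => {ω | H (z j ω) < E / 2} with hD
  have hDm : ∀ j, MeasurableSet (D j) := fun j => measurableSet_lt (hHm.comp (hzm j)) measurable_const
  set U : ℕ → Set WienerPair := fun j => {ω | 3 * E / 2 < H (z j ω)} with hU
  have hUm : ∀ j, MeasurableSet (U j) := fun j => measurableSet_lt measurable_const (hHm.comp (hzm j))
  set Nb : ℕ → Set WienerPair := fun j =>
    {ω | pairShift ((j : ℝ) * τ).toNNReal ω ∉ goodPaths (m₁ * a) τ.toNNReal} with hNb
  have hNbm : ∀ j, MeasurableSet (Nb j) := fun j =>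
    ((measurable_pairShift (s := ((j : ℝ) * τ).toNNReal)) (measurableSet_goodPaths (m₁ * a) τ.toNNReal)).compl
  set S₃ : Set WienerPair := (⋃ j ∈ range (J + 1), U j) ∪ (⋃ j ∈ range J, Nb j) with hS₃
  have hS₃m : MeasurableSet S₃ := (Finset.measurableSet_biUnion _ fun j _ => hUm j).union
    (Finset.measurableSet_biUnion _ fun j _ => hNbm j)
  ----------------------------------------------------------------
  -- Step 3: off `S₃` and the `D_j`, the dissipation is at least `g` (Cor. 5.4, sure)
  ----------------------------------------------------------------
  have hcover : ∀ ω, ω ∉ S₃ → (∀ j ∈ range (J + 1), ω ∉ D j) → ω ∈ SΓ := by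
    intro ω h3 hD'
    simp only [hS₃, Set.mem_union, Set.mem_iUnion, not_or, not_exists, exists_prop, not_and] at h3
    obtain ⟨hU', hNb'⟩ := h3
    have hgrid : ∀ j : ℕ, j < J → a ^ 4 / 2 ≤ P.hamiltonian N (P.solMap N T_L T_R (j * τ) x (pairPath ω)) ∧
        P.hamiltonian N (P.solMap N T_L T_R (j * τ) x (pairPath ω)) ≤ 3 * a ^ 4 / 2 := by
      intro j hj
      have hj' : j ∈ range (J + 1) := mem_range.2 (by omega)
      have h1 := hD' j hj'
      have h2 := hU' j hj'
      simp only [hD, hU, hz, Set.mem_setOf_eq, not_lt] at h1 h2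
      rw [ha4]
      exact ⟨by linarith only [h1], by linarith only [h2]⟩
    have hgood : ∀ j : ℕ, j < J → pairShift ((j : ℝ) * τ).toNNReal ω ∈ goodPaths (m₁ * a) τ.toNNReal := by
      intro j hj
      have := hNb' j (mem_range.2 hj)
      simpa only [hNb, Set.mem_setOf_eq, not_not] using this
    have hdis := pinnedChain_grid_dissipation_ge hω hl.le hβ.le hγ.le hN T_L T_R hF5 hcell haa₀ haa₁ hτ0.le
      hτ1 hτ2 hm'0 hnoise hnoise2 x J ω hgrid hgood
    rw [hJτ] at hdis
    show g ≤ Γ ω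
    calc g = (J : ℝ) * (γ * (ε₁ * a ^ 4 * τ)) := by
          rw [hg, ← ha4, ← hJτ]; ring
      _ ≤ Γ ω := hdis
  -- pointwise domination of `F`
  have hdom : ∀ ω, F ω ≤ SΓ.indicator F ω + (∑ j ∈ range (J + 1), (D j).indicator F ω) + S₃.indicator F ω := by
    intro ω
    by_cases h3 : ω ∈ S₃
    · rw [Set.indicator_of_mem h3]
      exact le_add_self
    · by_cases hD' : ∃ j ∈ range (J + 1), ω ∈ D j
      · obtain ⟨j, hj, hωj⟩ := hD'
        have : F ω ≤ ∑ j ∈ range (J + 1), (D j).indicator F ω := by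
          calc F ω = (D j).indicator F ω := (Set.indicator_of_mem hωj F).symm
            _ ≤ ∑ j ∈ range (J + 1), (D j).indicator F ω :=
                Finset.single_le_sum (f := fun j => (D j).indicator F ω) (fun _ _ => bot_le) hj
        exact this.trans (le_add_left le_rfl |>.trans (le_add_right le_rfl))
      · push Not at hD'
        rw [Set.indicator_of_mem (hcover ω h3 hD')]
        exact le_add_right (le_add_right le_rfl)
  ----------------------------------------------------------------
  -- Step 4: the three integral bounds
  ----------------------------------------------------------------
  -- (T1) large dissipation: the exponential supermartingale (Lemma 5.5)
  have hT1 : ∫⁻ ω, SΓ.indicator F ω ∂wienerPair ≤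
      ENNReal.ofReal (Real.exp (-(κ * g)) * Real.exp (θ * E + Cst * tstar)) := by
    have hpt : ∀ ω, SΓ.indicator F ω ≤ ENNReal.ofReal (Real.exp (-(κ * g))) *
        ENNReal.ofReal (Real.exp (θ * H (P.solMap N T_L T_R tstar x (pairPath ω)) + κ * Γ ω)) := by
      intro ω
      by_cases hω : ω ∈ SΓ
      · rw [Set.indicator_of_mem hω, hF, ← ENNReal.ofReal_mul (Real.exp_pos _).le, ← Real.exp_add]
        refine ENNReal.ofReal_le_ofReal (Real.exp_le_exp.2 ?_)
        have : g ≤ Γ ω := hω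
        nlinarith only [this, hκ0]
      · rw [Set.indicator_of_notMem hω]; exact bot_le
    refine (lintegral_mono hpt).trans ?_
    have hm2 : Measurable fun ω => ENNReal.ofReal (Real.exp (θ * H (P.solMap N T_L T_R tstar x (pairPath ω)) + κ * Γ ω)) :=
      ENNReal.measurable_ofReal.comp (Real.measurable_exp.comp
        (((hHm.comp (pinnedChain_measurable_solMap_pairPath_right hω hl.le hβ.le hγ.le N T_L T_R tstar x)).const_mul _).add
          (hΓm.const_mul _)))
    rw [lintegral_const_mul _ hm2, ENNReal.ofReal_mul (Real.exp_pos _).le]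
    gcongr
    have h := pinnedChain_lintegral_exp_hamiltonian_add_dissipation_le hω hl.le hβ.le hγ.le N hTL.le hTR.le hN θ hts.le x
    simpa only [hκ, hCst] using h
  -- (T2) low grid energy: restart and (3.4)
  have hT2 : ∀ j ∈ range (J + 1), ∫⁻ ω, (D j).indicator F ω ∂wienerPair ≤
      ENNReal.ofReal (Real.exp (Cst * tstar) * Real.exp (θ * (E / 2))) := by
    intro j hj
    have h := highEnergyDecayRate_restart_le hω hl.le hβ.le hγ.le hN0 hTL hTR hθ hθ'
      (by positivity : (0 : ℝ) ≤ j * τ) (hjτ j (mem_range.1 hj)) x (E / 2)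
    simpa only [hCst] using h
  -- (T3) the bad events: Hölder, Chebyshev and the sub-Gaussian noise tail
  have hU_le : ∀ j ∈ range (J + 1), wienerPair (U j) ≤
      ENNReal.ofReal (Real.exp (-(θ * (3 * E / 2))) * (Real.exp (Cst * tstar) * Real.exp (θ * E))) := by
    intro j hj
    have hj' := mem_range.1 hj
    have hsj : (((j : ℝ) * τ).toNNReal : ℝ) = j * τ := Real.coe_toNNReal _ (by positivity)
    have h := pinnedChain_measure_lt_hamiltonian_solMap_le hω hl.le hβ.le hγ.le hN0 hTL hTR hθ hθ'
      ((j : ℝ) * τ).toNNReal x (3 * E / 2)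
    rw [hsj] at h
    refine h.trans (ENNReal.ofReal_le_ofReal ?_)
    refine mul_le_mul_of_nonneg_left (mul_le_mul_of_nonneg_right (Real.exp_le_exp.2 ?_) (Real.exp_pos _).le)
      (Real.exp_pos _).le
    rw [hCst]
    exact mul_le_mul_of_nonneg_left (hjτ j hj') hCst0
  have hNb_le : ∀ j ∈ range J, wienerPair (Nb j) ≤
      ENNReal.ofReal (max Cg 0 * Real.exp (-(cg * m₁ ^ 2 / (2 * Λ₀) * a ^ 3))) := fun j _ =>
    highEnergyDecayRate_noiseCell_le hTail hcg.le hΛ₀ hm₁0 ha0 hτ0 hτ2 _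
  set u₁ : ℝ := Real.exp (-(θ * (3 * E / 2))) * (Real.exp (Cst * tstar) * Real.exp (θ * E)) with hu₁
  set u₂ : ℝ := max Cg 0 * Real.exp (-(cg * m₁ ^ 2 / (2 * Λ₀) * a ^ 3)) with hu₂
  have hu₁0 : 0 ≤ u₁ := by positivity
  have hu₂0 : 0 ≤ u₂ := by positivity
  set Y : ℝ := (J + 1) * u₁ + J * u₂ with hY
  have hY0 : 0 ≤ Y := by positivity
  have hJ' : ENNReal.ofReal ((J : ℝ) + 1) = (J : ℝ≥0∞) + 1 := by
    rw [ENNReal.ofReal_add (Nat.cast_nonneg J) zero_le_one, ENNReal.ofReal_natCast, ENNReal.ofReal_one]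
  have hS₃_le : wienerPair S₃ ≤ ENNReal.ofReal Y := by
    calc wienerPair S₃ ≤ wienerPair (⋃ j ∈ range (J + 1), U j) + wienerPair (⋃ j ∈ range J, Nb j) :=
          measure_union_le _ _
      _ ≤ (∑ j ∈ range (J + 1), wienerPair (U j)) + ∑ j ∈ range J, wienerPair (Nb j) :=
          add_le_add (measure_biUnion_finset_le _ _) (measure_biUnion_finset_le _ _)
      _ ≤ (∑ j ∈ range (J + 1), ENNReal.ofReal u₁) + ∑ j ∈ range J, ENNReal.ofReal u₂ :=
          add_le_add (Finset.sum_le_sum hU_le) (Finset.sum_le_sum hNb_le)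
      _ = ENNReal.ofReal Y := by
          rw [Finset.sum_const, Finset.sum_const, card_range, card_range, nsmul_eq_mul, nsmul_eq_mul, hY,
            ENNReal.ofReal_add (by positivity : 0 ≤ ((J : ℝ) + 1) * u₁) (by positivity : 0 ≤ (J : ℝ) * u₂),
            ENNReal.ofReal_mul (by positivity : 0 ≤ (J : ℝ) + 1), ENNReal.ofReal_mul (Nat.cast_nonneg J),
            ENNReal.ofReal_natCast, hJ']
          push_cast
          ring
  have hT3 : ∫⁻ ω, S₃.indicator F ω ∂wienerPair ≤
      ENNReal.ofReal (Real.exp (Cst * tstar) * Real.exp (θ * E)) * ENNReal.ofReal Y ^ (1 / q) := by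
    have hind : ∀ ω, S₃.indicator F ω = S₃.indicator 1 ω * F ω := fun ω => by
      by_cases hω : ω ∈ S₃
      · rw [Set.indicator_of_mem hω, Set.indicator_of_mem hω, Pi.one_apply, one_mul]
      · rw [Set.indicator_of_notMem hω, Set.indicator_of_notMem hω, zero_mul]
    simp_rw [hind]
    have h := pinnedChain_lintegral_indicator_exp_hamiltonian_le_rpow hω hl.le hβ.le hγ.le hN0 hTL hTR hθ hp1 hpθ
      tstar.toNNReal x hS₃m
    rw [Real.coe_toNNReal tstar hts.le] at h
    refine h.trans ?_
    rw [← hCst, ← hq]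
    gcongr
  ----------------------------------------------------------------
  -- Step 5: assemble
  ----------------------------------------------------------------
  have hsum : ∫⁻ ω, F ω ∂wienerPair ≤
      ENNReal.ofReal (Real.exp (-(κ * g)) * Real.exp (θ * E + Cst * tstar)) +
      (J + 1) * ENNReal.ofReal (Real.exp (Cst * tstar) * Real.exp (θ * (E / 2))) +
      ENNReal.ofReal (Real.exp (Cst * tstar) * Real.exp (θ * E)) * ENNReal.ofReal Y ^ (1 / q) := by
    calc ∫⁻ ω, F ω ∂wienerPair
        ≤ ∫⁻ ω, (SΓ.indicator F ω + (∑ j ∈ range (J + 1), (D j).indicator F ω) + S₃.indicator F ω) ∂wienerPair :=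
          lintegral_mono hdom
      _ = (∫⁻ ω, SΓ.indicator F ω ∂wienerPair) + (∑ j ∈ range (J + 1), ∫⁻ ω, (D j).indicator F ω ∂wienerPair) +
            ∫⁻ ω, S₃.indicator F ω ∂wienerPair := by
          rw [lintegral_add_right _ (hFm.indicator hS₃m), lintegral_add_left (hFm.indicator hSΓm),
            lintegral_finsetSum _ fun j _ => hFm.indicator (hDm j)]
      _ ≤ _ := by
          refine add_le_add (add_le_add hT1 ?_) hT3
          calc ∑ j ∈ range (J + 1), ∫⁻ ω, (D j).indicator F ω ∂wienerPair
              ≤ ∑ j ∈ range (J + 1), ENNReal.ofReal (Real.exp (Cst * tstar) * Real.exp (θ * (E / 2))) :=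
                Finset.sum_le_sum hT2
            _ = _ := by rw [Finset.sum_const, card_range, nsmul_eq_mul]; push_cast; ring
  -- everything as one real number
  set X₁ : ℝ := Real.exp (-(κ * g)) * Real.exp (θ * E + Cst * tstar) with hX₁
  set X₂ : ℝ := Real.exp (Cst * tstar) * Real.exp (θ * (E / 2)) with hX₂
  set X₃ : ℝ := Real.exp (Cst * tstar) * Real.exp (θ * E) with hX₃
  have hX₁0 : 0 ≤ X₁ := by rw [hX₁]; positivity
  have hX₂0 : 0 ≤ X₂ := by rw [hX₂]; positivity
  have hX₃0 : 0 ≤ X₃ := by rw [hX₃]; positivity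
  have hreal : ENNReal.ofReal (X₁ + (J + 1) * X₂ + X₃ * Y ^ (1 / q)) =
      ENNReal.ofReal X₁ + (J + 1) * ENNReal.ofReal X₂ + ENNReal.ofReal X₃ * ENNReal.ofReal Y ^ (1 / q) := by
    have h1 : 0 ≤ ((J : ℝ) + 1) * X₂ := by positivity
    have h2 : 0 ≤ X₃ * Y ^ (1 / q) := by positivity
    have h3 : 0 ≤ X₁ + ((J : ℝ) + 1) * X₂ := by positivity
    rw [ENNReal.ofReal_add h3 h2, ENNReal.ofReal_add hX₁0 h1, ENNReal.ofReal_mul (by positivity : 0 ≤ (J : ℝ) + 1),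
      ENNReal.ofReal_mul hX₃0, ENNReal.ofReal_rpow_of_nonneg hY0 hq0.le, hJ']
  ----------------------------------------------------------------
  -- Step 6: the real bookkeeping `X₁ + (J+1)X₂ + X₃ Y^{1/q} ≤ C e^{θE - c a³}`, `a³ = E^{3/4}`
  ----------------------------------------------------------------
  have hfin : X₁ + (J + 1) * X₂ + X₃ * Y ^ (1 / q) ≤ C * Real.exp (θ * E - c * a ^ 3) := by
    rw [hX₁, hX₂, hX₃, hY, hu₁, hu₂, hg]
    exact hbook a E J haA ha4 hJr
  calc ∫⁻ ω, F ω ∂wienerPair ≤ _ := hsum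
    _ = ENNReal.ofReal (X₁ + (J + 1) * X₂ + X₃ * Y ^ (1 / q)) := hreal.symm
    _ ≤ ENNReal.ofReal (C * Real.exp (θ * E - c * a ^ 3)) := ENNReal.ofReal_le_ofReal hfin
    _ = ENNReal.ofReal (C * Real.exp (θ * E - c * E ^ (3 / 4 : ℝ))) := by rw [ha3]

end Summit.AtomisticToContinuum.FouriersLaw.Cruxes.StaticKubo.Birth.Stubs

end
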